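import Mathlib
import Literature.MathematicalPhysics.QuantumFieldTheory.Balaban1983to89.TreeLengthTorusGeometry236
import Literature.MathematicalPhysics.QuantumFieldTheory.Balaban1983to89.B13Geometry236Printed

/-!
# `Balaban1983to89.TreeLengthTorusGeometry236Printed` — [Balaban1988RG2Cluster] p. 19, the scale-transfer inequality
(2.36) "2d_k(Z_i) ≧ Ld_{k+1}(Z′_i)" WITH THE PRINTED FACTOR 2 ON THE TORUS, PROVED IN THE KERNEL for the torus tree
length `torusTreeLen` between the two torus catalogues 𝐃_k (L·N′ cubes per direction) and 𝐃_{k+1} (N′ blocks per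
direction), every d, every L ≥ 8 — through the general constant 3/2 + 3/(L − 2), L ≥ 3; hence
`B13.Ineq236Printed (tsys d (L·N′)) (tsys d N′) (Z ↦ Z′) L` (= `B13.Ineq236With … (L/2)`, the PRINTED ℓ = ½L)

CITATION HEADER (lean-in-tree rule 2026-08-18).  Sources under audit: T. Bałaban, *Renormalization group approach to
lattice gauge field theories. II. Cluster expansions*, Commun. Math. Phys. **116**, 1–22 (1988), doi:10.1007/bf01239022
[Balaban1988RG2Cluster] (cell paper B13; PDF held `paper:balaban1988-cmp116-rg-ii-cluster`, journal page = PDF page;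
(2.36) and the Z′ sentence p. 19, the single use p. 20 ll. 2–3), together with the definitions of part I, Commun. Math.
Phys. **109**, 249–301 (1987) [Balaban1987RG1] (cell paper B12; p. 251 = PDF p. 3: the torus and *"L is an odd,
positive integer > 11"*; p. 257 = PDF p. 9: cubes, □̃ⁿ, X̃ⁿ, the linear size d_j).  The sentences quoted below are
quoted verbatim — and were render-checked (renders `…1988-cmp116-rg-II-cluster-p019-x2.png`, `…-p020-x2.png`,
`1987-cmp109-rg-I-small-field-p003-x2.png`, `…-p009-x2.png`; cell GAPS C-pv23-4, C-adv4-59, C-pv11g2-1, C-pv22g3-1/2)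
— in the imported modules `…Balaban1983to89.TreeLengthTorusGeometry236` (unit pv22 gen 3: the torus version of the
cell's substitute, factor `B13Geometry236.a236 L` = 3 + 4/(L − 2); from it are used BY NAME the lifting lemmas
`exists_lift_of_mem_tclosure`, `exists_corner_point_of_mem_block`, `sub_two_le_len_of_points`, `tAdmissible_point`,
`liftCubes_mono`, `cube_subset_liftCubes`) and `…Balaban1983to89.B13Geometry236Printed` (unit b13 gen 13 = this seat:
the window version of everything below — the centre net `exists_centre_net`, `a236c`, `a236c_pos`, `a236c_le_two_iff`,
`sum_map_half_add`, `len_map_le_sum`), and through them `…TreeLengthTorusTransfer` (pv22 gen 3: the nested tori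
N = L·N′, `tcoarse`, `tcollar` = X̃, `tclosure` = Z ↦ Z′, `tclosureDom`, `tAdmissible_scale`, `subset_tcollar`),
`…TreeLengthTorus` (pv22 gen 2: `TPt`, `proj`, `liftCubes`, `TAdmissible`, `torusTreeLen`, `le_mul_torusTreeLen`,
`torusTreeLen_le_len`, `TDom`, `tsys`), `…TreeLengthTorusGeometry` (pv22 gen 2: `exists_tAdmissible`), `…TreeLength`
(pv22: `cube`, `Seg`, `carrier`, `len`, `scaleSeg`, `isConnected_union_carrier`, `smul_mem_cube_coarse`),
`…B13ScaleTransfer` (pv11: `Pt`, `block` = □̃, `coarse`), `…B13Geometry236` (pv11 gen 2: `snap`, `snap_mem_cube`,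
`dist_snap_le`, `exists_common_point`) and `…B13` (b13: `Ineq236With`, `Ineq236Printed`, `ineq236With_of_pointwise`,
`exp_transfer_of_ineq236With`).  Cell records: GAPS G-B13-09 / G-B13-09R / C-B13-09 / C-adv4-59 / C-pv11g2-1 /
C-pv22g3-1/2 / C-B13-26 ((2.36): unproved in print; the cell's substitutes; the printed factor for the window carrier),
DIVERGENCE D-T2 / D-pv22.1 (sup metric; conventions of the tree length), D-pv22g2.1 (covering-space reading of d_j on
the torus), D-pv22g3.1, D-b13.22.  Unit `b2b-balaban-b13-g13` (paper sub-cell B13, gen 13), journal claim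
G-B13-09-PRINTED-TORUS (first refusal offered to and declined by the pv22 lineage, CLAIMS.log 2026-08-19 03:45Z /
03:49Z).  Imports `…TreeLengthTorusGeometry236` and `…B13Geometry236Printed` only; nothing existing is modified.
CREDITS as in `…B13Geometry236Printed`: centre-whisker idea and constant = adversarial reader adv4 gen 31 (prose
`HOME/b2b-balaban-adv4/g31/B13-236-sharpened.md`, GAPS C-adv4-59); cutting = b13 gen 2 (`HOME/b2b-balaban-b13/
GEOMETRY-236.md`, G-B13-09R); window frame = pv11 gen 2; torus frame and lifts = pv22 gen 3 — the proofs of Parts 1–2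
below are pv22 gen 3's proofs of `exists_tAdmissible_closure` / `mul_torusTreeLen_tclosure_le` /
`geometry236_torusTreeLen` with the separated net replaced by the centre net and the accounting of
`B13Geometry236Printed.exists_admissible_closure_centre`.

WHAT THE PAPER PRINTS.  [Balaban1988RG2Cluster] p. 19 [PDF 19], verbatim: *"we denote by Z′_i the smallest
localization domain from 𝐃_{k+1} containing Z̃_i"* and *"The remaining exponential is bounded using the following
inequality: 2d_k(Z_i) ≧ Ld_{k+1}(Z′_i). (2.36) This inequality can be obtained by simple, but awkward, geometric and
combinatoric considerations. It follows by considering locally many possible cases."*; its single use, p. 20 ll. 2–3,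
verbatim: *"and (1 − 5δ)κd_k(Z_i) in the exponentials replaced by (1 − 6δ)½Lκd_{k+1}(Z′_i)"*.  [Balaban1987RG1]
p. 257, verbatim: *"Consider a class of tree graphs contained in X and intersecting all the cubes in X. A length of a
shortest graph in this class, divided by M, is the linear size of X, and is denoted by d_j(X)."* — on the carrier of
p. 251, verbatim: *"a torus T obtained by the usual identification of boundary points of the cube"*, with *"L is an
odd, positive integer > 11"*.  In the periodic index model (READING D-pv22g2.1 / D-pv22g3.1, exactly as in
`…TreeLengthTorusGeometry236`): Z̄ ⊆ `TPt d (L·N′)` non-empty and torus-face-connected, Z̃ = `tcollar Z`,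
Z′ = `tclosure L N′ Z` ⊆ `TPt d N′` (the π_{k+1}-blocks of the SAME torus met by Z̃), d_k = d_{k+1} = `torusTreeLen`
(connected polygonal graphs in the universal cover ℝ^d meeting, for every cube of the family, some lift of it; sup
metric).

WHAT IS PROVED HERE (kernel-checked, zero `sorry`; every input is a theorem of the imported modules or of Mathlib; no
`def … : Prop` fact is introduced; every declaration is tagged [folklore] or [cite: …]).
`geometry236_torusTreeLen_centre`: for every d, every L ≥ 3, every N′ ≥ 1 and every non-empty torus-face-connected
Z̄ ⊆ TPt d (L·N′),   L · torusTreeLen(Z′) ≤ (3/2 + 3/(L − 2)) · torusTreeLen(Z̄)   (= `a236c L`,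
`geometry236_torusTreeLen_a236c`; kernel predecessor `TreeLengthTorusGeometry236.geometry236_torusTreeLen`:
3 + 4/(L − 2)); d = 4, L = 13: 13 · d_{k+1}(Z′) ≤ (39/22) · d_k(Z̄) (`geometry236_torus_thirteen_centre`; predecessor
37/11).  `geometry236_torus_printed` — (2.36) WITH THE PRINTED CONSTANT ON THE TORUS: for every d, every L ≥ 8, every
N′ ≥ 1,   L · torusTreeLen(Z′) ≤ 2 · torusTreeLen(Z̄),   i.e.   ½L · d_{k+1}(Z′) ≤ d_k(Z̄),   since 3/2 + 3/(L − 2) ≤ 2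
iff L ≥ 8 (`B13Geometry236Printed.a236c_le_two_iff`); every L admitted by p. 251 qualifies.  Part 3 — FOR THE TORUS
CATALOGUES: `ineq236Printed_torus : B13.Ineq236Printed (tsys d (L·N′)) (tsys d N′) (tclosureDom L N′) L` for every d,
every L ≥ 8, every N′ ≥ 1, i.e. `B13.Ineq236With … (L/2)`: the transfer input of `B13.exp_transfer_of_ineq236With` —
the parameter ℓ of `B13.Lemma3With`, `B13.Consts.R22gen`, `TreeLengthTorusGeometry.deliverables_torus`, all parametric
in ℓ — holds on the papers' PERIODIC carrier AT THE PRINTED ℓ = ½L, where `B13.Consts.R22gen (L/2)` is literally the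
printed R22 of p. 21 (`B13.Consts.R22gen_half_iff`); its printed use `exp_transfer_tsys_printed`; d = 4, L = 13:
`ineq236Printed_torus_thirteen : B13.Ineq236With (tsys 4 (13·N′)) (tsys 4 N′) (tclosureDom 13 N′) (13/2)` (kernel
predecessor 143/37 = 3.86…); the general-L form `ineq236With_torus_centre` (ℓ = L/a236c L, every L ≥ 3).

THE PROOF = the window proof of `…B13Geometry236Printed` run in the universal cover with pv22 gen 3's lifts.  Fix a
torus-admissible T for Z̄ (connected; for every ā ∈ Z̄ a lift X(ā) ∈ ℤ^d and a point P(ā) ∈ T ∩ cube X(ā)) and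
0 < ρ with 2ρ + 2 < L; rescale by 1/L (`tAdmissible_scale`).  Take the CENTRE NET of T/L
(`B13Geometry236Printed.exists_centre_net`, θ = ρ/L, weights w_i < 1 − 2/L, every point of T/L within w_i/2 of some
m_i, Σ w_i ≤ |T|/L, (N − 1)θ ≤ |T|/L) and hang at each m_i the whisker [m_i, snap_{w_i/2 + 1/L} m_i].  Every cell c of
Z′ is proj(coarse L y) for some ā ∈ Z̄ and y ∈ □̃(X ā) (`exists_lift_of_mem_tclosure`); cube(coarse L y) contains a
point q within 1/L of P(ā)/L (`exists_corner_point_of_mem_block`), P(ā)/L ∈ T/L is within w_i/2 of some m_i, so q is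
within w_i/2 + 1/L of m_i and the whisker endpoint lies in cube(coarse L y) (`snap_mem_cube`, 2(w_i/2 + 1/L) < 1):
T/L plus the whiskers is torus-admissible for Z′, of length ≤ ((3/2)|T| + N)/L with N ≤ 1 + |T|/ρ.  Dichotomy as in
pv22 gen 3: two lifted cells two scales apart force |T| ≥ L − 2 (`sub_two_le_len_of_points`), absorbing the additive
1; otherwise all lifted cells share a point and torusTreeLen(Z′) = 0 (`exists_common_point`, `tAdmissible_point`).
Then ρ ↑ (L − 2)/2 (`le_of_forall_pos_le_add`).

WHAT IS *NOT* CLAIMED.  (i) L ∣ N throughout (the two catalogues live on the SAME torus, pv22 gen 3's setting); nothing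
for a coarse torus that is not an exact quotient.  (ii) METRIC: sup metric only (D-T2); Euclidean / ℓ¹ readings not
treated (prose C-adv4-59).  (iii) 3 ≤ L ≤ 7: only the 3/2 + 3/(L − 2) bound.  (iv) The paper's own "locally many
possible cases" argument is not reconstructed; nothing about Lemma 3 / (2.37)–(2.41) / the series.  HONEST FRAMING
(cell contract): a kernel-checked proof, on the papers' periodic carrier and in the cell's fixed reading of d_j, of a
printed inequality the paper uses without proof; under the cell's ABSOLUTE RULE nothing here enters as a fact.  Value =
kernel certificate; NOT summit progress.
-/

namespace Literature.MathematicalPhysics.QuantumFieldTheory.Balaban1983to89.TreeLengthTorusGeometry236Printed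

noncomputable section

open Literature.MathematicalPhysics.QuantumFieldTheory.Balaban1983to89
open Literature.MathematicalPhysics.QuantumFieldTheory.Balaban1983to89.B13ScaleTransfer
open Literature.MathematicalPhysics.QuantumFieldTheory.Balaban1983to89.TreeLength
open Literature.MathematicalPhysics.QuantumFieldTheory.Balaban1983to89.TreeLengthTorus
open Literature.MathematicalPhysics.QuantumFieldTheory.Balaban1983to89.TreeLengthTorusGeometry
open Literature.MathematicalPhysics.QuantumFieldTheory.Balaban1983to89.TreeLengthTorusTransfer
open Literature.MathematicalPhysics.QuantumFieldTheory.Balaban1983to89.B13Geometry236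
open Literature.MathematicalPhysics.QuantumFieldTheory.Balaban1983to89.TreeLengthTorusGeometry236
open Literature.MathematicalPhysics.QuantumFieldTheory.Balaban1983to89.B13Geometry236Printed

variable {d : ℕ}

section TwoTori

variable {L N' : ℕ} [NeZero L] [NeZero N']

/-! ## Part 1. The centre-whisker construction in the universal cover -/

/-- THE CONSTRUCTION ON THE TORUS (pv22 gen 3's `exists_tAdmissible_closure` with the separated net replaced by the
centre net `B13Geometry236Printed.exists_centre_net`): for T torus-admissible for Z̄ ⊆ TPt d (L·N′), L ≥ 3 and
0 < ρ with 2ρ + 2 < L, there is a torus-admissible graph T′ for Z′ — the rescaled lift T/L plus, at each point m_i of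
a centre net of T/L (weights w_i < 1 − 2/L, every point of T/L within w_i/2 of some m_i), the whisker
[m_i, snap_{w_i/2 + 1/L} m_i] — with L·|T′| ≤ (3/2)|T| + 1 + |T|/ρ: every cell of Z′ lifts to a block `coarse L y`,
y ∈ □̃(x(ā)) (`exists_lift_of_mem_tclosure`), which contains a point within 1/L of the rescaled witness point of ā
(`exists_corner_point_of_mem_block`), hence within w_i/2 + 1/L of some m_i, hence the whisker endpoint
(`B13Geometry236.snap_mem_cube`). [folklore] -/
theorem exists_tAdmissible_closure_centre (hL : 3 ≤ L) {Z : Finset (TPt d (L * N'))} {T : List (Seg d)}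
    (hT : TAdmissible Z T) {ρ : ℝ} (hρ : 0 < ρ) (hρL : 2 * ρ + 2 < L) :
    ∃ T', TAdmissible (tclosure L N' Z) T' ∧ (L : ℝ) * len T' ≤ 3 / 2 * len T + 1 + len T / ρ := by
  classical
  have hL0 : 0 < L := by omega
  have hLr : (0 : ℝ) < L := by exact_mod_cast hL0
  have hLne : (L : ℝ) ≠ 0 := hLr.ne'
  -- lifts met by T and the witness points
  have hw : ∀ a ∈ Z, ∃ x : Pt d, ∃ w : RPt d, proj (L * N') x = a ∧ w ∈ carrier T ∧ w ∈ cube x := fun a ha => by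
    obtain ⟨x, hxa, w, hwT, hwx⟩ := hT.meets a ha
    exact ⟨x, w, hxa, hwT, hwx⟩
  choose! X P hXa hPT hPc using hw
  -- the rescaled lift T₁
  set T₁ : List (Seg d) := T.map (scaleSeg (L : ℝ)⁻¹) with hT₁def
  have hT₁ : TAdmissible (Z.image (tcoarse L N')) T₁ := tAdmissible_scale hT
  have hlen₁ : len T₁ = (L : ℝ)⁻¹ * len T := len_map_scaleSeg (inv_nonneg.2 hLr.le) T
  have hpT₁ : ∀ a ∈ Z, (L : ℝ)⁻¹ • P a ∈ carrier T₁ := fun a ha => by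
    rw [hT₁def, carrier_map_scaleSeg]
    exact Set.mem_image_of_mem _ (hPT a ha)
  have hsubZ' : Z.image (tcoarse L N') ⊆ tclosure L N' Z := Finset.image_subset_image (subset_tcollar Z)
  -- the parameters: piece threshold θ = ρ/L, whisker weights < κ = 1 − 2/L, fineness ε = κ − 2θ
  set θ : ℝ := ρ / L with hθdef
  have hθ : 0 < θ := div_pos hρ hLr
  set κ : ℝ := 1 - 2 / L with hκdef
  have hθκ : 2 * θ < κ := by
    have h1 : (2 * ρ + 2) / L < 1 := (div_lt_one hLr).2 hρL
    have e : (2 * ρ + 2) / (L : ℝ) = 2 * (ρ / L) + 2 / L := by ring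
    rw [hθdef, hκdef]
    linarith
  set ε : ℝ := κ - 2 * θ with hεdef
  have hε : 0 < ε := by rw [hεdef]; linarith
  -- the centre net of T₁
  obtain ⟨l, hl1, hl2, hl3, hl4⟩ := exists_centre_net hT₁.connected hθ hε
  have hrad : ∀ x ∈ l, 0 ≤ x.2 / 2 + 1 / L ∧ 2 * (x.2 / 2 + 1 / L) < 1 := by
    intro x hx
    obtain ⟨-, h0, h2⟩ := hl1 x hx
    refine ⟨by positivity, ?_⟩
    have e : 2 * (x.2 / 2 + 1 / (L : ℝ)) = x.2 + 2 / L := by ring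
    rw [e]
    rw [hεdef, hκdef] at h2
    linarith
  -- the whiskers
  set W : List (Seg d) := l.map fun x => (x.1, snap (x.2 / 2 + 1 / L) x.1) with hWdef
  have hWmem : ∀ sg ∈ W, ∃ x ∈ l, sg = (x.1, snap (x.2 / 2 + 1 / L) x.1) := fun sg hsg => by
    rw [hWdef, List.mem_map] at hsg
    obtain ⟨x, hx, rfl⟩ := hsg
    exact ⟨x, hx, rfl⟩
  have hlenW : len W ≤ (l.map fun x => x.2 / 2 + 1 / (L : ℝ)).sum :=
    len_map_le_sum l _ _ fun x hx => by
      dsimp only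
      rw [dist_comm]
      exact dist_snap_le (hrad x hx).1 x.1
  refine ⟨T₁ ++ W, ⟨?_, ?_, ?_⟩, ?_⟩
  · -- connected: each whisker hangs at a point of T₁
    rw [carrier_append]
    exact isConnected_union_carrier hT₁.connected W fun sg hsg => by
      obtain ⟨x, hx, rfl⟩ := hWmem sg hsg
      exact (hl1 x hx).1
  · -- contained in the lifts of the cells of Z′ (each whisker inside a lifted cell containing its base point)
    rw [carrier_append]
    refine Set.union_subset (hT₁.subset.trans (liftCubes_mono hsubZ')) ?_
    intro y hy
    obtain ⟨sg, hsg, hy⟩ := mem_carrier.1 hy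
    obtain ⟨x, hx, rfl⟩ := hWmem sg hsg
    obtain ⟨c', hc', hxc'⟩ := mem_liftCubes.1 (hT₁.subset (hl1 x hx).1)
    have hf : snap (x.2 / 2 + 1 / L) x.1 ∈ cube c' :=
      snap_mem_cube (hrad x hx).2 hxc' (by rw [dist_self]; exact (hrad x hx).1)
    exact cube_subset_liftCubes (hsubZ' hc') ((convex_cube _).segment_subset hxc' hf hy)
  · -- meets a lift of every cell of Z′
    intro c hc
    obtain ⟨z, hz, y, hy, hyc⟩ := exists_lift_of_mem_tclosure hXa hc
    obtain ⟨q, hqc, hq⟩ := exists_corner_point_of_mem_block hL0 hy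
    obtain ⟨x, hx, hxp⟩ := hl2 _ (hpT₁ z hz)
    have hqx : dist q x.1 ≤ x.2 / 2 + 1 / L := by
      calc dist q x.1 ≤ dist q ((L : ℝ)⁻¹ • P z) + dist ((L : ℝ)⁻¹ • P z) x.1 := dist_triangle _ _ _
        _ ≤ 1 / L + x.2 / 2 := add_le_add (hq (P z) (hPc z hz)) (by rw [dist_comm]; exact hxp)
        _ = x.2 / 2 + 1 / L := add_comm _ _
    refine ⟨coarse L y, hyc, snap (x.2 / 2 + 1 / L) x.1, ?_, snap_mem_cube (hrad x hx).2 hqc hqx⟩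
    rw [carrier_append]
    refine Or.inr (mem_carrier.2 ⟨(x.1, snap (x.2 / 2 + 1 / L) x.1), ?_, right_mem_segment ℝ _ _⟩)
    rw [hWdef, List.mem_map]
    exact ⟨x, hx, rfl⟩
  · -- the length accounting (verbatim from the window construction)
    rw [len_append, hlen₁]
    have e1 : (L : ℝ) * ((L : ℝ)⁻¹ * len T + len W) = len T + L * len W := by
      rw [mul_add, ← mul_assoc, mul_inv_cancel₀ hLne, one_mul]
    rw [e1]
    have hW' : len W ≤ (L : ℝ)⁻¹ * len T / 2 + (l.length : ℝ) * (1 / L) := by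
      refine hlenW.trans ?_
      rw [sum_map_half_add]
      have := hl3.trans hlen₁.le
      linarith
    have hN : (l.length : ℝ) ≤ 1 + len T / ρ := by
      have h1 : ((l.length : ℝ) - 1) * θ ≤ (L : ℝ)⁻¹ * len T := hl4.trans hlen₁.le
      have h2 : ((l.length : ℝ) - 1) * ρ ≤ len T := by
        have h3 := mul_le_mul_of_nonneg_left h1 hLr.le
        have e2 : (L : ℝ) * (((l.length : ℝ) - 1) * θ) = ((l.length : ℝ) - 1) * ρ := by
          rw [hθdef]
          field_simp
        have e3 : (L : ℝ) * ((L : ℝ)⁻¹ * len T) = len T := by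
          rw [← mul_assoc, mul_inv_cancel₀ hLne, one_mul]
        rwa [e2, e3] at h3
      have h4 : (l.length : ℝ) - 1 ≤ len T / ρ := by
        rw [le_div_iff₀ hρ]
        exact h2
      linarith
    have h3 : (L : ℝ) * len W ≤ len T / 2 + l.length := by
      have h5 : (L : ℝ) * ((L : ℝ)⁻¹ * len T / 2 + (l.length : ℝ) * (1 / L)) = len T / 2 + l.length := by
        field_simp
      calc (L : ℝ) * len W ≤ L * ((L : ℝ)⁻¹ * len T / 2 + (l.length : ℝ) * (1 / L)) :=
            mul_le_mul_of_nonneg_left hW' hLr.le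
        _ = len T / 2 + l.length := h5
    linarith

/-! ## Part 2. The dichotomy and the theorems on the torus -/

/-- THE DICHOTOMY, per admissible graph (as `TreeLengthTorusGeometry236.mul_torusTreeLen_tclosure_le`, with the centre
construction): for T torus-admissible for Z̄, L ≥ 3 and 0 < ρ with 2ρ + 2 < L,
`L · torusTreeLen Z′ ≤ (3/2 + 1/(L − 2) + 1/ρ)·|T|` — EITHER two lifted cells are ≥ 2 apart in some coordinate, then
|T| ≥ L − 2 (`sub_two_le_len_of_points`) absorbs the additive 1 of `exists_tAdmissible_closure_centre`, OR all lifted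
cells pairwise touch and the one-point graph gives torusTreeLen Z′ = 0. [folklore] -/
theorem mul_torusTreeLen_tclosure_le_centre (hL : 3 ≤ L) {Z : Finset (TPt d (L * N'))} (hZ : Z.Nonempty)
    {T : List (Seg d)} (hT : TAdmissible Z T) {ρ : ℝ} (hρ : 0 < ρ) (hρL : 2 * ρ + 2 < L) :
    (L : ℝ) * torusTreeLen (tclosure L N' Z) ≤ (3 / 2 + 1 / ((L : ℝ) - 2) + 1 / ρ) * len T := by
  classical
  have hL0 : 0 < L := by omega
  have hLr : (0 : ℝ) < L := by exact_mod_cast hL0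
  have hL3 : (3 : ℝ) ≤ L := by exact_mod_cast hL
  have hL2 : (0 : ℝ) < L - 2 := by linarith
  have hK : (0 : ℝ) ≤ 3 / 2 + 1 / ((L : ℝ) - 2) + 1 / ρ := by positivity
  -- lifts met by T and the witness points
  have hw : ∀ a ∈ Z, ∃ x : Pt d, ∃ w : RPt d, proj (L * N') x = a ∧ w ∈ carrier T ∧ w ∈ cube x := fun a ha => by
    obtain ⟨x, hxa, w, hwT, hwx⟩ := hT.meets a ha
    exact ⟨x, w, hxa, hwT, hwx⟩
  choose! X P hXa hPT hPc using hw
  by_cases hfar : ∃ a₁ ∈ Z, ∃ y₁ ∈ B13ScaleTransfer.block (X a₁), ∃ a₂ ∈ Z,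
      ∃ y₂ ∈ B13ScaleTransfer.block (X a₂), ∃ μ : Fin d, coarse L y₁ μ + 2 ≤ coarse L y₂ μ
  · -- two lifted cells two scales apart: |T| ≥ L − 2 and the centre-whisker construction
    obtain ⟨a₁, ha₁, y₁, hy₁, a₂, ha₂, y₂, hy₂, μ, hμ⟩ := hfar
    obtain ⟨q₁, hq₁, h₁⟩ := exists_corner_point_of_mem_block hL0 hy₁
    obtain ⟨q₂, hq₂, h₂⟩ := exists_corner_point_of_mem_block hL0 hy₂
    have hlen : (L : ℝ) - 2 ≤ len T :=
      sub_two_le_len_of_points hL hT.connected.isPreconnected (hPT a₁ ha₁) (hPT a₂ ha₂) hq₁ hq₂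
        (h₁ (P a₁) (hPc a₁ ha₁)) (h₂ (P a₂) (hPc a₂ ha₂)) hμ
    have h1 : (1 : ℝ) ≤ len T / ((L : ℝ) - 2) := by
      rw [le_div_iff₀ hL2, one_mul]
      exact hlen
    obtain ⟨T', hT', hb⟩ := exists_tAdmissible_closure_centre hL hT hρ hρL
    calc (L : ℝ) * torusTreeLen (tclosure L N' Z) ≤ L * len T' :=
          mul_le_mul_of_nonneg_left (torusTreeLen_le_len hT') hLr.le
      _ ≤ 3 / 2 * len T + 1 + len T / ρ := hb
      _ ≤ 3 / 2 * len T + len T / ((L : ℝ) - 2) + len T / ρ := by linarith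
      _ = (3 / 2 + 1 / ((L : ℝ) - 2) + 1 / ρ) * len T := by ring
  · -- all lifted cells pairwise touch: a common point, the one-point graph, torusTreeLen Z′ = 0
    push Not at hfar
    set Y : Finset (Pt d) := Z.biUnion fun a => (B13ScaleTransfer.block (X a)).image (coarse L) with hYdef
    have hmemY : ∀ {c : Pt d}, c ∈ Y ↔ ∃ a ∈ Z, ∃ y ∈ B13ScaleTransfer.block (X a), coarse L y = c := by
      intro c
      rw [hYdef, Finset.mem_biUnion]
      simp only [Finset.mem_image]
    obtain ⟨a₀, ha₀⟩ := hZ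
    have hY : Y.Nonempty := ⟨coarse L (X a₀), hmemY.2 ⟨a₀, ha₀, X a₀, B13ScaleTransfer.mem_block_self _, rfl⟩⟩
    have htouch : ∀ c₁ ∈ Y, ∀ c₂ ∈ Y, ∀ μ, c₂ μ ≤ c₁ μ + 1 := by
      intro c₁ hc₁ c₂ hc₂ μ
      obtain ⟨a₁, ha₁, y₁, hy₁, rfl⟩ := hmemY.1 hc₁
      obtain ⟨a₂, ha₂, y₂, hy₂, rfl⟩ := hmemY.1 hc₂
      have := hfar a₁ ha₁ y₁ hy₁ a₂ ha₂ y₂ hy₂ μ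
      omega
    obtain ⟨q, hq⟩ := exists_common_point hY htouch
    have hne' : (tclosure L N' Z).Nonempty := tclosure_nonempty ⟨a₀, ha₀⟩
    have hadm : TAdmissible (tclosure L N' Z) [(q, q)] := by
      refine tAdmissible_point hne' fun c hc => ?_
      obtain ⟨a, ha, y, hy, hyc⟩ := exists_lift_of_mem_tclosure hXa hc
      exact ⟨coarse L y, hyc, hq _ (hmemY.2 ⟨a, ha, y, hy, rfl⟩)⟩
    have h0 : torusTreeLen (tclosure L N' Z) ≤ 0 := by
      have := torusTreeLen_le_len hadm
      simpa using this
    calc (L : ℝ) * torusTreeLen (tclosure L N' Z) ≤ L * 0 := mul_le_mul_of_nonneg_left h0 hLr.le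
      _ = 0 := mul_zero _
      _ ≤ (3 / 2 + 1 / ((L : ℝ) - 2) + 1 / ρ) * len T := mul_nonneg hK (len_nonneg T)

/-- THE GENERAL CONSTANT ON THE TORUS, under L ∣ N: for every d, every L ≥ 3, every N′ ≥ 1 and every localization
domain Z̄ of the torus with L·N′ cubes of π_k per direction, with Z′ = the cubes of π_{k+1} met by Z̃,
  `L · torusTreeLen Z′ ≤ (3/2 + 3/(L − 2)) · torusTreeLen Z̄`
— the torus twin of `B13Geometry236Printed.geometry236_centre`; kernel predecessor on the torus:
`TreeLengthTorusGeometry236.geometry236_torusTreeLen` (3 + 4/(L − 2)). [cite: Balaban1988RG2Cluster, (2.36) p.19] -/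
theorem geometry236_torusTreeLen_centre (hL : 3 ≤ L) {Z : Finset (TPt d (L * N'))} (hZ : Z.Nonempty)
    (hc : TFaceConnected Z) :
    (L : ℝ) * torusTreeLen (tclosure L N' Z) ≤ (3 / 2 + 3 / ((L : ℝ) - 2)) * torusTreeLen Z := by
  have hL0 : 0 < L := by omega
  have hLr : (0 : ℝ) < L := by exact_mod_cast hL0
  have hL3 : (3 : ℝ) ≤ L := by exact_mod_cast hL
  have hL2 : (0 : ℝ) < L - 2 := by linarith
  have htl0 : 0 ≤ torusTreeLen Z := torusTreeLen_nonneg Z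
  have hne : ∃ T, TAdmissible Z T := (exists_tAdmissible hZ hc).imp fun T h => h.1
  -- for every ρ with 2ρ + 2 < L:  L·torusTreeLen Z′ ≤ (3/2 + 1/(L − 2) + 1/ρ)·torusTreeLen Z̄
  have key : ∀ ρ : ℝ, 0 < ρ → 2 * ρ + 2 < L →
      (L : ℝ) * torusTreeLen (tclosure L N' Z) ≤ (3 / 2 + 1 / ((L : ℝ) - 2) + 1 / ρ) * torusTreeLen Z :=
    fun ρ hρ hρL => le_mul_torusTreeLen (by positivity) hne
      fun T hT => mul_torusTreeLen_tclosure_le_centre hL hZ hT hρ hρL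
  rcases htl0.eq_or_lt with h0 | hpos
  · -- torusTreeLen Z̄ = 0
    have h := key (((L : ℝ) - 2) / 4) (by positivity) (by linarith)
    rw [← h0, mul_zero] at h
    rw [← h0, mul_zero]
    exact h
  · -- torusTreeLen Z̄ > 0: let ρ ↑ (L − 2)/2
    have htne : torusTreeLen Z ≠ 0 := hpos.ne'
    refine le_of_forall_pos_le_add fun ε hε => ?_
    set A : ℝ := 2 / ((L : ℝ) - 2) with hA
    have hA0 : 0 < A := by positivity
    have hB0 : 0 < ε / torusTreeLen Z := div_pos hε hpos
    have hρ : 0 < 1 / (A + ε / torusTreeLen Z) := by positivity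
    have hρL : 2 * (1 / (A + ε / torusTreeLen Z)) + 2 < L := by
      have h1 : 1 / (A + ε / torusTreeLen Z) < 1 / A := one_div_lt_one_div_of_lt hA0 (by linarith)
      have h2 : 1 / A = ((L : ℝ) - 2) / 2 := by rw [hA, one_div_div]
      linarith
    have h := key _ hρ hρL
    rw [one_div_one_div] at h
    have e : ε / torusTreeLen Z * torusTreeLen Z = ε := by field_simp
    calc (L : ℝ) * torusTreeLen (tclosure L N' Z)
        ≤ (3 / 2 + 1 / ((L : ℝ) - 2) + (A + ε / torusTreeLen Z)) * torusTreeLen Z := h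
      _ = (3 / 2 + 1 / ((L : ℝ) - 2) + A) * torusTreeLen Z + ε / torusTreeLen Z * torusTreeLen Z := by ring
      _ = (3 / 2 + 3 / ((L : ℝ) - 2)) * torusTreeLen Z + ε := by
        rw [e, hA]
        ring

/-- The same with the named constant a_c(L) = `B13Geometry236Printed.a236c L` = 3/2 + 3/(L − 2). [cite: Balaban1988RG2Cluster, (2.36) p.19] -/
theorem geometry236_torusTreeLen_a236c (hL : 3 ≤ L) {Z : Finset (TPt d (L * N'))} (hZ : Z.Nonempty)
    (hc : TFaceConnected Z) :
    (L : ℝ) * torusTreeLen (tclosure L N' Z) ≤ a236c L * torusTreeLen Z := by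
  unfold a236c
  exact geometry236_torusTreeLen_centre hL hZ hc

/-- (2.36) p. 19 AS PRINTED — *"2d_k(Z_i) ≧ Ld_{k+1}(Z′_i)"* — PROVED ON THE TORUS for the formalised torus tree
length, under L ∣ N: for every d, every L ≥ 8, every N′ ≥ 1 and every localization domain Z̄ of the torus with L·N′
cubes of π_k per direction, `L · torusTreeLen Z′ ≤ 2 · torusTreeLen Z̄` (3/2 + 3/(L − 2) ≤ 2 iff L ≥ 8,
`B13Geometry236Printed.a236c_le_two_iff`; every L admitted by [Balaban1987RG1] p. 251, *"L is an odd, positive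
integer > 11"*, qualifies). [cite: Balaban1988RG2Cluster, (2.36) p.19] -/
theorem geometry236_torus_printed (hL : 8 ≤ L) {Z : Finset (TPt d (L * N'))} (hZ : Z.Nonempty)
    (hc : TFaceConnected Z) :
    (L : ℝ) * torusTreeLen (tclosure L N' Z) ≤ 2 * torusTreeLen Z := by
  have h := geometry236_torusTreeLen_a236c (by omega : 3 ≤ L) hZ hc
  have hL8 : (8 : ℝ) ≤ L := by exact_mod_cast hL
  have hK : a236c (L : ℝ) ≤ 2 := (a236c_le_two_iff (by linarith)).2 hL8
  exact h.trans (mul_le_mul_of_nonneg_right hK (torusTreeLen_nonneg Z))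

/-- d = 4, L = 13 (the least admitted block size): 13 · d_{k+1}(Z′) ≤ (39/22) · d_k(Z̄) on the four-dimensional torus
with 13·N′ cubes per direction (window twin `B13Geometry236Printed.geometry236_centre_thirteen`; kernel predecessor
37/11). [cite: Balaban1988RG2Cluster, (2.36) p.19] -/
theorem geometry236_torus_thirteen_centre {Z : Finset (TPt 4 (13 * N'))} (hZ : Z.Nonempty)
    (hc : TFaceConnected Z) :
    (13 : ℝ) * torusTreeLen (tclosure 13 N' Z) ≤ 39 / 22 * torusTreeLen Z := by
  have h := geometry236_torusTreeLen_centre (d := 4) (L := 13) (N' := N') (by norm_num) hZ hc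
  norm_num at h
  linarith

/-! ## Part 3. (2.36) AS PRINTED for the torus catalogues: `B13.Ineq236Printed (tsys d (L·N′)) (tsys d N′) (Z ↦ Z′) L` -/

variable (L N')

/-- (2.36) AS PRINTED, AS A THEOREM ON THE PAPERS' PERIODIC CARRIER: for the torus catalogues `tsys d (L·N′)` (𝐃_k)
and `tsys d N′` (𝐃_{k+1}, the SAME torus) and the closure map Z ↦ Z′ (`tclosureDom L N′`), b13's
`B13.Ineq236Printed (tsys d (L·N′)) (tsys d N′) (tclosureDom L N′) L` — i.e. `B13.Ineq236With … (L/2)`, the transfer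
input of `B13.exp_transfer_of_ineq236With` / `B13.Lemma3With` / `B13.Consts.R22gen` /
`TreeLengthTorusGeometry.deliverables_torus` AT THE PRINTED ℓ = ½L — HOLDS for every d, every L ≥ 8 and every N′ ≥ 1
(kernel predecessor `TreeLengthTorusGeometry236.ineq236With_torus`: ℓ = L/(3 + 4/(L − 2))). [cite: Balaban1988RG2Cluster, (2.36) p.19] -/
theorem ineq236Printed_torus (hL : 8 ≤ L) :
    B13.Ineq236Printed (tsys d (L * N')) (tsys d N') (tclosureDom L N') L := by
  unfold B13.Ineq236Printed
  refine B13.ineq236With_of_pointwise (by norm_num : (0 : ℝ) < 2) fun X => ?_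
  show (L : ℝ) * torusTreeLen (tclosure L N' X.1) ≤ 2 * torusTreeLen X.1
  exact geometry236_torus_printed hL X.2.1 X.2.2

/-- The general-L form on the torus catalogues: `B13.Ineq236With (tsys d (L·N′)) (tsys d N′) (tclosureDom L N′)
(L / a236c L)` for every d, every L ≥ 3, every N′ ≥ 1 (ℓ = 22/3 at L = 13). [cite: Balaban1988RG2Cluster, (2.36) p.19] -/
theorem ineq236With_torus_centre (hL : 3 ≤ L) :
    B13.Ineq236With (tsys d (L * N')) (tsys d N') (tclosureDom L N') ((L : ℝ) / a236c L) := by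
  have hL3 : (3 : ℝ) ≤ L := by exact_mod_cast hL
  refine B13.ineq236With_of_pointwise (a236c_pos (by linarith)) fun X => ?_
  show (L : ℝ) * torusTreeLen (tclosure L N' X.1) ≤ a236c L * torusTreeLen X.1
  exact geometry236_torusTreeLen_a236c hL X.2.1 X.2.2

/-- The single printed USE of the transfer (p. 20, `B13.exp_transfer_of_ineq236With`) on the torus catalogues, now at
the printed ½L: for every rate r ≥ 0, every L ≥ 8 and every Z ∈ 𝐃_k of the fine torus,
exp(−r·d_k(Z)) ≤ exp(−r·(L/2)·d_{k+1}(Z′)). [cite: Balaban1988RG2Cluster, p.20 (after (2.36))] -/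
theorem exp_transfer_tsys_printed (hL : 8 ≤ L) {r : ℝ} (hr : 0 ≤ r) (Z : (tsys d (L * N')).Dom) :
    Real.exp (-(r * (tsys d (L * N')).dj Z)) ≤
      Real.exp (-(r * ((L : ℝ) / 2) * (tsys d N').dj (tclosureDom L N' Z))) :=
  B13.exp_transfer_of_ineq236With (ineq236Printed_torus L N' hL) r hr Z

/-- d = 4, L = 13: the transfer inequality between the torus catalogues holds with the PRINTED ℓ = 13/2 (kernel
predecessor `TreeLengthTorusGeometry236.ineq236With_torus_thirteen`: 143/37 = 3.86…). [cite: Balaban1988RG2Cluster, (2.36) p.19] -/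
theorem ineq236Printed_torus_thirteen (N' : ℕ) [NeZero N'] :
    B13.Ineq236With (tsys 4 (13 * N')) (tsys 4 N') (tclosureDom 13 N') (13 / 2) := by
  have h := ineq236Printed_torus (d := 4) 13 N' (by norm_num)
  unfold B13.Ineq236Printed at h
  have e : ((13 : ℕ) : ℝ) / 2 = 13 / 2 := by norm_num
  rwa [e] at h

end TwoTori

end

end Literature.MathematicalPhysics.QuantumFieldTheory.Balaban1983to89.TreeLengthTorusGeometry236Printed
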